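import Literature.AlgebraicGeometry.Deformation.SmoothSchemeLiftObstructionCriterionGluePullback
import HarnessLib

/-!
# Gluing the lifted charts, IX: TRIVIAL gluing data — cocycle-exactness, compatibility with an augmentation, and the
# projection of the re-glued scheme to the closed fibre (Hartshorne, *Deformation Theory*, proof of Thm. 10.2 (a))

HOME SEED (cell `hodgecm-mathlib`, F-11 (A3) F3b FILE 6a; provisional path
`Deformation/SmoothSchemeLiftObstructionCriterionGlueTrivial.lean`).  Theorems only; imports FILE 5.

TRIVIAL gluing data `ψ j l = 1` (characterised: `ψ j l x = x`) over any coefficient `k`-algebra `R` re-glue the charts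
`Spec (R ⊗_k Γ(U j))` along the identity — the TRIVIAL deformation `X ×_k Spec R` (for `R = k`: the closed fibre `X`
itself, FILE 6b).  This file supplies what the glue chain (FILES 2–5) needs to treat them:

* §1 `algEquiv_apply_eq_self_of_restrict` — an `R`-automorphism of `R ⊗_k Γ(W)`, `W = D(f) ⊆ V` principal in an affine
  `V`, that fixes the image of `R ⊗_k Γ(V)` is the identity (`Γ(W)` is a localisation of `Γ(V)`): the restricted
  automorphisms `ρ` of the cocycle clause are UNIQUE;
* §2 `sub_mem_smul_top_of_trivial`, **`cocycle_of_trivial`** — trivial data are admissible (`ψ ≡ 1`) and COCYCLE-EXACT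
  in F3a's `∀`-form (every `ρ` is `1` by §1);
* §3 `map_eq_map_of_sub_mem_smul_top`, **`compatible_of_trivial`** — along a `k`-algebra map `σ : R → R'` KILLING `𝔫`,
  data `ψ ≡ 1 (mod 𝔫)` over `R` are compatible (FILE 4b's `hψσ`) with trivial data over `R'` (the case `σ = ε : A → k`,
  the augmentation of an Artinian local `k`-algebra: «`X'` restricts to `X` over the closed point»);
* §4 `transitionMap_comp_chartProj_of_trivial`, **`existsUnique_proj`**, `preimage_proj_eq_opensRange` — for trivial data
  the transition maps commute with the chart projections to `X`, so the projections glue to a unique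
  `π : X'_R(1) ⟶ X` with `ι j ≫ π = chartProj j`, and `π⁻¹(U j)` is exactly the `j`-th chart.

HC_CM is proved only modulo the 7 printed citations until rung 0 closes — nothing here bears on a summit statement.

## References
* [Hartshorne2010] R. Hartshorne, *Deformation Theory*, GTM 257, Springer (2010): Thm. 10.2 (a) and its proof (p. 81);
  §5 p. 38 (trivial deformations).
* [StacksProject] The Stacks Project, Tag 01JA (glueing schemes; functoriality), Tag 01LH (relative glueing).
* [Hartshorne1977] R. Hartshorne, *Algebraic Geometry*, GTM 52 (1977): II Prop. 2.2 (b), II Ex. 2.16 (a)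
  (`Γ(D(f)) = Γ(V)_f`).
* [AtiyahMacdonald1969] M. F. Atiyah, I. G. Macdonald, *Introduction to Commutative Algebra* (1969): Ch. 2 (pp. 30–31).
-/

noncomputable section

-- `TopCat.Presheaf`/`TopCat.Sheaf` are not reducible (as in Mathlib's `AlgebraicGeometry/Modules`).
set_option backward.isDefEq.respectTransparency false

open CategoryTheory AlgebraicGeometry Opposite TopologicalSpace Limits
open scoped TensorProduct

universe u

namespace Literature.AlgebraicGeometry.Deformation

open Literature.AlgebraicGeometry.Motives Literature.AlgebraicGeometry.Morphisms

variable {k : Type u} [Field k] {X : Over (Spec (CommRingCat.of k))}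
  [instΓ : ∀ W : X.left.Opens, Algebra k Γ(X.left, W)]
  (halg : ∀ (W : X.left.Opens) (s : k), algebraMap k Γ(X.left, W) s = (constToPresheaf X).app (op W) s)
  (R : Type u) [CommRing R] [Algebra k R]
  {ι : Type u} (U : ι → X.left.affineOpens) (b : (j l : ι) → Γ(X.left, (U j).1))
  (hb : ∀ j l, (U j).1 ⊓ (U l).1 = X.left.basicOpen (b j l))
  (ψ : (j l : ι) → R ⊗[k] Γ(X.left, (U j).1 ⊓ (U l).1) ≃ₐ[R] R ⊗[k] Γ(X.left, (U j).1 ⊓ (U l).1))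
  (𝔫 : Ideal R) (h𝔫 : IsNilpotent 𝔫)
  (hψ : ∀ j l x, ψ j l x - x ∈ 𝔫 • (⊤ : Submodule R (R ⊗[k] Γ(X.left, (U j).1 ⊓ (U l).1))))
  (hcoc : ∀ (j l m : ι)
    (Φjl : R ⊗[k] Γ(X.left, (U j).1 ⊓ (U l).1) →ₐ[R] R ⊗[k] Γ(X.left, (U j).1 ⊓ (U l).1 ⊓ (U m).1))
    (_ : ∀ a s, Φjl (a ⊗ₜ s) = a ⊗ₜ X.left.presheaf.map (homOfLE inf_le_left).op s)
    (Φlm : R ⊗[k] Γ(X.left, (U l).1 ⊓ (U m).1) →ₐ[R] R ⊗[k] Γ(X.left, (U j).1 ⊓ (U l).1 ⊓ (U m).1))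
    (_ : ∀ a s, Φlm (a ⊗ₜ s) = a ⊗ₜ X.left.presheaf.map
      (homOfLE (le_inf (inf_le_left.trans inf_le_right) inf_le_right)).op s)
    (Φjm : R ⊗[k] Γ(X.left, (U j).1 ⊓ (U m).1) →ₐ[R] R ⊗[k] Γ(X.left, (U j).1 ⊓ (U l).1 ⊓ (U m).1))
    (_ : ∀ a s, Φjm (a ⊗ₜ s) = a ⊗ₜ X.left.presheaf.map
      (homOfLE (le_inf (inf_le_left.trans inf_le_left) inf_le_right)).op s)
    (ρjl ρlm ρjm : R ⊗[k] Γ(X.left, (U j).1 ⊓ (U l).1 ⊓ (U m).1) ≃ₐ[R]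
      R ⊗[k] Γ(X.left, (U j).1 ⊓ (U l).1 ⊓ (U m).1)),
    (∀ x, ρjl (Φjl x) = Φjl (ψ j l x)) → (∀ x, ρlm (Φlm x) = Φlm (ψ l m x)) →
    (∀ x, ρjm (Φjm x) = Φjm (ψ j m x)) → ρlm * ρjl = ρjm)
  (hψ1 : ∀ j l x, ψ j l x = x)

/-! ## §1 Restricted automorphisms are unique -/

omit instΓ in
/-- **An `R`-automorphism of `R ⊗_k Γ(W)` fixing the image of `R ⊗_k Γ(V)` is the identity** when `W = D(f) ⊆ V` is a
principal open of an affine `V` (`Γ(W) = Γ(V)_f`, so ring maps out of `Γ(W)` are determined on `Γ(V)`; then use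
`R`-linearity).  Hence the restrictions `ρ` in F3a's cocycle clause are uniquely determined by `ψ`.
[cite: Hartshorne1977, II Prop. 2.2 (b) and II Ex. 2.16 (a)] [cite: Hartshorne2010, Thm. 10.2 (proof), p. 81] -/
theorem algEquiv_apply_eq_self_of_restrict [∀ W : X.left.Opens, Algebra k Γ(X.left, W)] {V W : X.left.Opens}
    (hV : IsAffineOpen V) (f : Γ(X.left, V)) (hWV : W ≤ V) (hWf : W = X.left.basicOpen f)
    {Φ : R ⊗[k] Γ(X.left, V) →ₐ[R] R ⊗[k] Γ(X.left, W)}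
    (hΦ : ∀ a s, Φ (a ⊗ₜ s) = a ⊗ₜ X.left.presheaf.map (homOfLE hWV).op s)
    (ρ : R ⊗[k] Γ(X.left, W) ≃ₐ[R] R ⊗[k] Γ(X.left, W)) (hρ : ∀ x, ρ (Φ x) = Φ x)
    (x : R ⊗[k] Γ(X.left, W)) : ρ x = x := by
  letI alg : Algebra Γ(X.left, V) Γ(X.left, W) := (X.left.presheaf.map (homOfLE hWV).op).hom.toAlgebra
  haveI : IsLocalization.Away f Γ(X.left, W) := hV.isLocalization_of_eq_basicOpen f (homOfLE hWV) hWf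
  -- the two ring maps `Γ(W) → R ⊗_k Γ(W)`, `t ↦ ρ (1 ⊗ t)` and `t ↦ 1 ⊗ t`, agree on `Γ(V)`, hence everywhere
  have key : ρ.toAlgHom.toRingHom.comp
      (Algebra.TensorProduct.includeRight (R := k) (A := R) (B := Γ(X.left, W))).toRingHom =
      (Algebra.TensorProduct.includeRight (R := k) (A := R) (B := Γ(X.left, W))).toRingHom := by
    refine IsLocalization.ringHom_ext (Submonoid.powers f) (RingHom.ext fun s => ?_)
    change ρ ((1 : R) ⊗ₜ X.left.presheaf.map (homOfLE hWV).op s) = (1 : R) ⊗ₜ X.left.presheaf.map (homOfLE hWV).op s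
    rw [← hΦ 1 s, hρ]
  have key' : ∀ t : Γ(X.left, W), ρ ((1 : R) ⊗ₜ t) = (1 : R) ⊗ₜ t := fun t => RingHom.congr_fun key t
  induction x using TensorProduct.induction_on with
  | zero => exact map_zero ρ
  | tmul a t =>
      calc ρ (a ⊗ₜ t) = ρ (a • ((1 : R) ⊗ₜ[k] t)) := by rw [TensorProduct.smul_tmul', smul_eq_mul, mul_one]
        _ = a • ρ ((1 : R) ⊗ₜ[k] t) := map_smul ρ a _
        _ = a ⊗ₜ t := by rw [key' t, TensorProduct.smul_tmul', smul_eq_mul, mul_one]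
  | add x y hx hy => rw [map_add, hx, hy]

/-! ## §2 Trivial gluing data are admissible and cocycle-exact -/

include hψ1 in
/-- Trivial data are admissible: `ψ x - x = 0 ∈ 𝔫 · (R ⊗_k Γ)`. [cite: Hartshorne2010, Thm. 10.2 (proof), p. 81] -/
theorem sub_mem_smul_top_of_trivial (j l : ι)
    (x : R ⊗[k] Γ(X.left, (U j).1 ⊓ (U l).1)) :
    ψ j l x - x ∈ 𝔫 • (⊤ : Submodule R (R ⊗[k] Γ(X.left, (U j).1 ⊓ (U l).1))) := by
  rw [hψ1, sub_self]
  exact Submodule.zero_mem _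

include hb hψ1 in
/-- **Trivial gluing data are COCYCLE-EXACT** in F3a's `∀`-form: each restricted automorphism `ρ` fixes the image of the
base change, hence is `1` (§1, the triple intersections being principal in the double ones), so `ρlm * ρjl = 1 = ρjm`.
[cite: Hartshorne2010, Thm. 10.2 (proof), p. 81] [cite: Hartshorne1977, II Ex. 2.16 (a)] -/
theorem cocycle_of_trivial (j l m : ι)
    (Φjl : R ⊗[k] Γ(X.left, (U j).1 ⊓ (U l).1) →ₐ[R] R ⊗[k] Γ(X.left, (U j).1 ⊓ (U l).1 ⊓ (U m).1))
    (hΦjl : ∀ a s, Φjl (a ⊗ₜ s) = a ⊗ₜ X.left.presheaf.map (homOfLE inf_le_left).op s)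
    (Φlm : R ⊗[k] Γ(X.left, (U l).1 ⊓ (U m).1) →ₐ[R] R ⊗[k] Γ(X.left, (U j).1 ⊓ (U l).1 ⊓ (U m).1))
    (hΦlm : ∀ a s, Φlm (a ⊗ₜ s) = a ⊗ₜ X.left.presheaf.map
      (homOfLE (le_inf (inf_le_left.trans inf_le_right) inf_le_right)).op s)
    (Φjm : R ⊗[k] Γ(X.left, (U j).1 ⊓ (U m).1) →ₐ[R] R ⊗[k] Γ(X.left, (U j).1 ⊓ (U l).1 ⊓ (U m).1))
    (hΦjm : ∀ a s, Φjm (a ⊗ₜ s) = a ⊗ₜ X.left.presheaf.map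
      (homOfLE (le_inf (inf_le_left.trans inf_le_left) inf_le_right)).op s)
    (ρjl ρlm ρjm : R ⊗[k] Γ(X.left, (U j).1 ⊓ (U l).1 ⊓ (U m).1) ≃ₐ[R]
      R ⊗[k] Γ(X.left, (U j).1 ⊓ (U l).1 ⊓ (U m).1))
    (hjl : ∀ x, ρjl (Φjl x) = Φjl (ψ j l x)) (hlm : ∀ x, ρlm (Φlm x) = Φlm (ψ l m x))
    (hjm : ∀ x, ρjm (Φjm x) = Φjm (ψ j m x)) : ρlm * ρjl = ρjm := by
  have e1 : ∀ x, ρjl x = x :=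
    algEquiv_apply_eq_self_of_restrict R (isAffineOpen_inf₂ U b hb j l)
      (X.left.presheaf.map (homOfLE (inf_le_left : (U j).1 ⊓ (U l).1 ≤ (U j).1)).op (b j m)) inf_le_left
      (inf_eq_basicOpen_map U b hb inf_le_left m) hΦjl ρjl (fun x => by rw [hjl, hψ1])
  have e2 : ∀ x, ρlm x = x :=
    algEquiv_apply_eq_self_of_restrict R (isAffineOpen_inf₂ U b hb l m)
      (X.left.presheaf.map (homOfLE (inf_le_left : (U l).1 ⊓ (U m).1 ≤ (U l).1)).op (b l j))
      (le_inf (inf_le_left.trans inf_le_right) inf_le_right)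
      (by rw [← inf_eq_basicOpen_map U b hb inf_le_left j]; ac_rfl) hΦlm ρlm (fun x => by rw [hlm, hψ1])
  have e3 : ∀ x, ρjm x = x :=
    algEquiv_apply_eq_self_of_restrict R (isAffineOpen_inf₂ U b hb j m)
      (X.left.presheaf.map (homOfLE (inf_le_left : (U j).1 ⊓ (U m).1 ≤ (U j).1)).op (b j l))
      (le_inf (inf_le_left.trans inf_le_left) inf_le_right)
      (by rw [← inf_eq_basicOpen_map U b hb inf_le_left l]; ac_rfl) hΦjm ρjm (fun x => by rw [hjm, hψ1])
  ext x
  rw [AlgEquiv.mul_apply, e1, e2, e3]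

/-! ## §3 Compatibility with a change of coefficients killing `𝔫` -/

omit instΓ in
/-- `σ ⊗ 1` kills `𝔫 · (R ⊗_k B)` when `σ` kills `𝔫`: elements congruent modulo `𝔫` have the same image.
[cite: AtiyahMacdonald1969, Ch. 2 (tensor product of algebras, pp. 30–31)] -/
theorem map_eq_map_of_sub_mem_smul_top {B : Type u} [CommRing B] [Algebra k B] {R' : Type u} [CommRing R']
    [Algebra k R'] (σ : R →ₐ[k] R') (hσ : ∀ n ∈ 𝔫, σ n = 0) {x y : R ⊗[k] B}
    (h : x - y ∈ 𝔫 • (⊤ : Submodule R (R ⊗[k] B))) :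
    Algebra.TensorProduct.map σ (AlgHom.id k B) x = Algebra.TensorProduct.map σ (AlgHom.id k B) y := by
  have h0 : ∀ z ∈ 𝔫 • (⊤ : Submodule R (R ⊗[k] B)), Algebra.TensorProduct.map σ (AlgHom.id k B) z = 0 := by
    intro z hz
    refine Submodule.smul_induction_on hz (fun r hr n _ => ?_) (fun x y hx hy => ?_)
    · rw [Algebra.smul_def, Algebra.TensorProduct.algebraMap_apply, Algebra.algebraMap_self, RingHom.id_apply, map_mul,
        Algebra.TensorProduct.map_tmul, hσ r hr, TensorProduct.zero_tmul, zero_mul]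
    · rw [map_add, hx, hy, add_zero]
  rw [← sub_eq_zero, ← map_sub]
  exact h0 _ h

include hψ in
/-- **Compatibility along an augmentation**: for a `k`-algebra map `σ : R → R'` KILLING `𝔫`, lifted data `ψ ≡ 1 (mod 𝔫)`
over `R` and TRIVIAL data `ψ'` over `R'` are compatible — `(σ ⊗ 1) ∘ ψ = ψ' ∘ (σ ⊗ 1)` (FILE 4b's `hψσ`).
[cite: Hartshorne2010, Thm. 10.2 (proof), p. 81] -/
theorem compatible_of_trivial {R' : Type u} [CommRing R'] [Algebra k R']
    (σ : R →ₐ[k] R') (hσ : ∀ n ∈ 𝔫, σ n = 0)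
    (ψ' : (j l : ι) → R' ⊗[k] Γ(X.left, (U j).1 ⊓ (U l).1) ≃ₐ[R'] R' ⊗[k] Γ(X.left, (U j).1 ⊓ (U l).1))
    (hψ'1 : ∀ j l x, ψ' j l x = x) (j l : ι) (x : R ⊗[k] Γ(X.left, (U j).1 ⊓ (U l).1)) :
    Algebra.TensorProduct.map σ (AlgHom.id k Γ(X.left, (U j).1 ⊓ (U l).1)) (ψ j l x) =
      ψ' j l (Algebra.TensorProduct.map σ (AlgHom.id k Γ(X.left, (U j).1 ⊓ (U l).1)) x) := by
  rw [hψ'1]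
  exact map_eq_map_of_sub_mem_smul_top R 𝔫 σ hσ (hψ j l x)

/-! ## §4 The projection of the re-glued scheme to the closed fibre -/

include hb hψ1 in
/-- **For trivial data the transition maps commute with the chart projections to `X`**: `t j l ≫ chartProj l = W j l ↪
Spec (R ⊗_k Γ(U j)) → X` (both are `W.toSpecΓ ≫ Spec (Λ ∘ (c ↦ 1 ⊗ c)) ≫ (U j ∩ U l ↪ X)`, FILE 1b).
[cite: Hartshorne2010, Thm. 10.2 (proof), p. 81] [cite: StacksProject, Tag 01JA] -/
theorem transitionMap_comp_chartProj_of_trivial (j l : ι) :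
    transitionMap halg R U ψ j l ≫ chartProj R U l = (chartOverlap R U j l).ι ≫ chartProj R U j := by
  have hψ' : ∀ y, (ψ j l).symm.toAlgHom.toRingHom y = y := fun y => by
    have h := hψ1 j l ((ψ j l).symm y)
    rw [AlgEquiv.apply_symm_apply] at h
    exact h.symm
  have eR : ((overlapRingHom halg R U j l).comp (ψ j l).symm.toAlgHom.toRingHom).comp
      (Algebra.TensorProduct.includeRight (R := k) (A := R) (B := Γ(X.left, (U j).1 ⊓ (U l).1))).toRingHom =
      (overlapRingHom halg R U j l).comp
        (Algebra.TensorProduct.includeRight (R := k) (A := R) (B := Γ(X.left, (U j).1 ⊓ (U l).1))).toRingHom :=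
    RingHom.ext fun c => congrArg (fun y => overlapRingHom halg R U j l y) (hψ' _)
  rw [ι_comp_chart (U j).2 (isAffineOpen_inf₂ U b hb j l) (chartProj R U j) rfl (chartOverlap_le R U j l)
    (overlapRingHom_one_tmul halg R U j l),
    show transitionMap halg R U ψ j l = (chartOverlap R U j l : Scheme.{u}).toSpecΓ ≫ Spec.map (CommRingCat.ofHom
      (((overlapRingHom halg R U j l).comp (ψ j l).symm.toAlgHom.toRingHom).comp
        (baseChangeRight halg R U j l).toRingHom)) from rfl,
    toSpecΓ_SpecMap_comp_chart (U l).2 (isAffineOpen_inf₂ U b hb j l) (chartProj R U l) rfl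
      ((overlapRingHom halg R U j l).comp (ψ j l).symm.toAlgHom.toRingHom) (baseChangeRight_tmul halg R U j l), eR]

include hψ1 in
/-- **THE PROJECTION TO THE CLOSED FIBRE**: for trivial data there is a unique `π : X'_R(1) ⟶ X` restricting to the
chart projection `Spec (R ⊗_k Γ(U j)) → U j ↪ X` on every chart (★ `glueData_existsUnique_desc`).
[cite: StacksProject, Tag 01JA] [cite: Hartshorne2010, Thm. 10.2 (proof), p. 81] -/
theorem existsUnique_proj :
    ∃! π : (deformationGlueDatum halg R U b hb ψ 𝔫 h𝔫 hψ hcoc).glueData.glued ⟶ X.left,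
      ∀ j, (deformationGlueDatum halg R U b hb ψ 𝔫 h𝔫 hψ hcoc).glueData.ι j ≫ π = chartProj R U j := by
  refine glueData_existsUnique_desc (deformationGlueDatum halg R U b hb ψ 𝔫 h𝔫 hψ hcoc).glueData
    (fun j => chartProj R U j) fun i j => ?_
  rw [OpensGlueDatum.glueData_f, OpensGlueDatum.glueData_f, OpensGlueDatum.glueData_t, ← Category.assoc,
    OpensGlueDatum.tLift_ι]
  change (chartOverlap R U i j).ι ≫ _ = transitionMap halg R U ψ i j ≫ _
  exact (transitionMap_comp_chartProj_of_trivial halg R U b hb ψ hψ1 i j).symm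

omit instΓ in
/-- The chart projection lands in `U j`. [cite: Hartshorne2010, Thm. 10.2 (proof), p. 81] -/
theorem chartProj_apply_mem [∀ W : X.left.Opens, Algebra k Γ(X.left, W)] (j : ι)
    (y : Spec (CommRingCat.of (R ⊗[k] Γ(X.left, (U j).1)))) : chartProj R U j y ∈ (U j).1 := by
  rw [chartProj_eq, Scheme.Hom.comp_apply]
  have h : (U j).2.fromSpec (Spec.map (CommRingCat.ofHom
      (Algebra.TensorProduct.includeRight (R := k) (A := R) (B := Γ(X.left, (U j).1))).toRingHom) y) ∈
      Set.range (U j).2.fromSpec := ⟨_, rfl⟩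
  rw [IsAffineOpen.range_fromSpec] at h
  exact h

/-- **`π⁻¹(U j)` is exactly the `j`-th chart**: a point `ι l y` with `π (ι l y) = chartProj l y ∈ U j` has
`y ∈ W l j`, so `ι l y = ι j (t l j y)`. [cite: StacksProject, Tag 01LH] [cite: Hartshorne2010, Thm. 10.2 (proof), p. 81] -/
theorem preimage_proj_eq_opensRange
    (π : (deformationGlueDatum halg R U b hb ψ 𝔫 h𝔫 hψ hcoc).glueData.glued ⟶ X.left)
    (hπ : ∀ j, (deformationGlueDatum halg R U b hb ψ 𝔫 h𝔫 hψ hcoc).glueData.ι j ≫ π = chartProj R U j) (j : ι) :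
    π ⁻¹ᵁ (U j).1 = ((deformationGlueDatum halg R U b hb ψ 𝔫 h𝔫 hψ hcoc).glueData.ι j).opensRange := by
  apply TopologicalSpace.Opens.ext
  simp only [TopologicalSpace.Opens.map_coe, Scheme.Hom.coe_opensRange]
  ext x
  constructor
  · intro hx
    obtain ⟨l, y, rfl⟩ := (deformationGlueDatum halg R U b hb ψ 𝔫 h𝔫 hψ hcoc).glueData.ι_jointly_surjective x
    have hy : chartProj R U l y ∈ (U l).1 ⊓ (U j).1 := by
      refine ⟨chartProj_apply_mem R U l y, ?_⟩
      have hx' : π (((deformationGlueDatum halg R U b hb ψ 𝔫 h𝔫 hψ hcoc).glueData.ι l) y) ∈ ((U j).1 : Set X.left) := hx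
      rwa [← Scheme.Hom.comp_apply, hπ l] at hx'
    refine ⟨(deformationGlueDatum halg R U b hb ψ 𝔫 h𝔫 hψ hcoc).t l j ⟨y, hy⟩, ?_⟩
    change ((deformationGlueDatum halg R U b hb ψ 𝔫 h𝔫 hψ hcoc).t l j ≫
      (deformationGlueDatum halg R U b hb ψ 𝔫 h𝔫 hψ hcoc).glueData.ι j) ⟨y, hy⟩ =
      (((deformationGlueDatum halg R U b hb ψ 𝔫 h𝔫 hψ hcoc).W l j).ι ≫
        (deformationGlueDatum halg R U b hb ψ 𝔫 h𝔫 hψ hcoc).glueData.ι l) ⟨y, hy⟩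
    rw [OpensGlueDatum.t_ι]
  · rintro ⟨y, rfl⟩
    change π (((deformationGlueDatum halg R U b hb ψ 𝔫 h𝔫 hψ hcoc).glueData.ι j) y) ∈ ((U j).1 : Set X.left)
    rw [← Scheme.Hom.comp_apply, hπ j]
    exact chartProj_apply_mem R U j y

end Literature.AlgebraicGeometry.Deformation

end
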